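import Summits.Langlands.Langlands.Theses.WachComponentCensus

/-!
# Route `WachComponentCensus` — the Assembly (item `stmt-Langlands-12046`)

The assembly item of route `Langlands/WachComponentCensus` is the bookkeeping implication

  `Assembly : LiftB2UnramSmallF → LiftB2UnramLargeF → LiftB2Unram`,

i.e. the two crux slices of the (B)-direction lifting target for `GL₂` over a totally real `F` at a
prime `p ≥ 7` unramified in `F` — `LiftB2UnramSmallF` (every place `v ∣ p` has residue field of
size `≤ p²`) and `LiftB2UnramLargeF` (some place `v ∣ p` has residue field of size `> p²`) —
together give the target `LiftB2Unram`.  The three decls share, verbatim, the same conclusion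
`∃ RD : ReciprocityData F, …`; they differ only in the extra hypothesis on the residue fields above
`p`, and those two hypotheses are complementary.  Pure logic (the same case split as the route's
deciding theorem `Theses.WachComponentCensus.closes`); no mathematics is carried here, by design of
the route [cite: BarnetlambEtAl2014 §1.4; Kisin2007] — the content lives in the two cruxes.

The route decls are used BY NAME; no statement of the route file is altered.
Axioms: `propext`, `Classical.choice`, `Quot.sound`.
-/

set_option linter.dupNamespace false -- project-wide option (lakefile weak.linter.dupNamespace); `Summit.Langlands.Langlands` is the mandated namespace

namespace Summit.Langlands.Langlands.Theorems

/-- **Assembly of route WachComponentCensus** (item `stmt-Langlands-12046`):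
`LiftB2UnramSmallF → LiftB2UnramLargeF → LiftB2Unram`.  Proof: unfold `Assembly`, fix the totally
real field `F` and the prime `p ≥ 7` with `p ∤ d_F`, and split on whether every nonzero prime `v`
of `𝓞 F` above `p` has `residueCard v ≤ p²`; in the first case apply the small-residue-degree
slice, otherwise some `v ∣ p` has `p² < residueCard v` and the large-residue-degree slice applies. -/
theorem wachComponentCensus_assembly_proof :
    Summit.Langlands.Langlands.Theses.WachComponentCensus.Assembly := by
  unfold Summit.Langlands.Langlands.Theses.WachComponentCensus.Assembly
  intro hS hL F _ _ _ p _ hp hdisc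
  by_cases h : ∀ v : IsDedekindDomain.HeightOneSpectrum (NumberField.RingOfIntegers F),
      ((p : ℕ) : NumberField.RingOfIntegers F) ∈ v.asIdeal → v.residueCard ≤ p ^ 2
  · exact hS F p hp hdisc h
  · simp only [not_forall, not_le, exists_prop] at h
    exact hL F p hp hdisc h

end Summit.Langlands.Langlands.Theorems
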